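import Summits.BirchSwinnertonDyer.BirchSwinnertonDyer.Theses.GenusKolyvaginAtTwo
import Summits.BirchSwinnertonDyer.BirchSwinnertonDyer.Theorems.GenusKolyvaginAtTwoK1OfWallU2
import HarnessLib

/-!
# SKELETON LINE `wall_u2_byname` for item 31525 `K1Neg` (route GenusKolyvaginAtTwo, support r201 — the depth-zero kernel K₁ on Δ < 0)

line-writer skeleton (linewriter-bsd-genuskolyattwo-1 g0); NOT leaf progress. `K1Neg` says: on the route's habitat (non-CM E/ℚ of analytic
rank 0, ρ_{E,2^∞} onto, odd Tamagawa product, Δ < 0) the K₁-cell `#Sel₂(E/ℚ) = 1` admits no Heegner frame (K, Dt, d₁, Sel₂-minimal twin Wd of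
analytic rank 1 with ord₂ c(Wd) ≤ 1) in which y_K is 2-DIVISIBLE (1 ≤ M₀) — i.e. y_K ∉ 2E(K[1]) on that cell, so n = 1 is the deep witness.
ROAD (landed, seat bsd-line-gk2-p2 g28, `Theorems/GenusKolyvaginAtTwoK1OfWallU2.lean` ★ `k1Neg_of_wallItems_of_minimalTwinBSDTwo`): the index
identity #Ш(E/K)[2^∞] = 4^{M₀} from BSD₂(E) ∧ BSD₂(Wd) (Gross–Zagier V (2.2) + Milne + Kramer; tree
`natCard_primaryComponent_sha_baseChange_two_eq_pow_of_bsdp_pair`) against #Ш(E/K)[2^∞] = 1 from the Selmer data (tree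
`natCard_primaryComponent_sha_baseChange_two_eq_one_of_natCard_selmerGroup_eq_one`) forces M₀ = 0. BSD₂(E) is WALL row 1 (the four rank-0
cells by reduction type at 2 = route items 19095–19098 BY NAME), BSD₂(Wd) is U₂ `MinimalTwinBSDTwo` (22985) BY NAME, the rest is print
(items 24148, 19273, 19921, 24149 BY NAME). CENSUS READING: K₁ is NOT an independent K-input of the route — it is WALL row 1 + U₂ + print;
conversely (card) K1Neg restricted to its cell is EQUIVALENT to the 2-part of BSD for the pair (E, Wd) there, so no road avoiding BSD₂-grade
input exists: the honest research content of K1Neg is exactly {WALL row 1 on the #Sel₂ = 1 cell} ∧ {U₂}.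
Composition = the landed theorem (kernel-checked); sorries ONLY inside `stub_*`; nothing asserted; BSD is proved for no curve.
-/

set_option autoImplicit false
set_option linter.dupNamespace false

namespace Summit.BirchSwinnertonDyer.BirchSwinnertonDyer.Cruxes.K1Neg.WallU2Byname

open Summit.BirchSwinnertonDyer.BirchSwinnertonDyer.Theses.GenusKolyvaginAtTwo
  (K1Neg WallGoodOrdinaryRankZeroAtTwo WallMultiplicativeRankZeroAtTwo WallSupersingularRankZeroAtTwo WallAdditiveRankZeroAtTwo
   MinimalTwinBSDTwo GrossZagierAllLevels EntireLFunctionRat MultPublishedInputsAtTwo MilneAnyModel)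

/-- [research · ITEM BY NAME = `WallGoodOrdinaryRankZeroAtTwo` 19095] WALL row 1, good ordinary at 2: BSD₂(E) for every non-CM E/ℚ of
analytic rank 0 with good ordinary reduction at 2 (route ByReductionTypeAtTwo's `GoodOrdinaryRankZeroAtTwo`, split there into
OrdPublishedInputs / OrdKatoHalf / OrdEisensteinHalf). [cite: Kato2004Asterisque, Thm. 17.4] [cite: SkinnerUrban2014, Thm. 3.29] -/
theorem stub_wallGoodOrdinaryRankZeroAtTwo : WallGoodOrdinaryRankZeroAtTwo := by
  sorry

/-- [research · ITEM BY NAME = `WallMultiplicativeRankZeroAtTwo` 19096] WALL row 1, multiplicative at 2. [cite: Kato2004Asterisque, Thm. 17.4]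
[cite: SkinnerAnnals2016Multiplicative, Thm. A] -/
theorem stub_wallMultiplicativeRankZeroAtTwo : WallMultiplicativeRankZeroAtTwo := by
  sorry

/-- [research · ITEM BY NAME = `WallSupersingularRankZeroAtTwo` 19097] WALL row 1, good supersingular at 2. [cite: Kato2004Asterisque, Thm. 17.4] -/
theorem stub_wallSupersingularRankZeroAtTwo : WallSupersingularRankZeroAtTwo := by
  sorry

/-- [research · ITEM BY NAME = `WallAdditiveRankZeroAtTwo` 19098] WALL row 1, additive at 2. [cite: Kato2004Asterisque, Thm. 17.4] -/
theorem stub_wallAdditiveRankZeroAtTwo : WallAdditiveRankZeroAtTwo := by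
  sorry

/-- [research · ITEM BY NAME = `MinimalTwinBSDTwo` 22985, crux r6 (U₂)] BSD₂ for every non-CM globally minimal E/ℚ of analytic rank 1 with
#Sel₂(E/ℚ) = 2. [cite: GrossZagier1986, V.§2 (2.2)] [cite: Zhang2014CambJMath, Thm. 1.1] -/
theorem stub_minimalTwinBSDTwo : MinimalTwinBSDTwo := by
  sorry

/-- [print · ITEMS BY NAME] `GrossZagierAllLevels` (24148, GZ 1986 Thm I.6.3) ∧ `EntireLFunctionRat` (19273, modularity) ∧
`MultPublishedInputsAtTwo` (19921, GZK Thm: rank = analytic rank ≤ 1 with Ш finite) ∧ `MilneAnyModel` (24149, Milne 1972 Thm 1).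
[cite: GrossZagier1986, Thm. I.6.3] [cite: BCDTJAMS2001, Thm. A] [cite: Darmon2004, Thm. 3.22] [cite: Milne1972ArithmeticAV, §1 Thm. 1] -/
theorem stub_printItems : GrossZagierAllLevels ∧ EntireLFunctionRat ∧ MultPublishedInputsAtTwo ∧ MilneAnyModel := by
  sorry

/-- **Composition (kernel-checked): `K1Neg`** (item 31525) BY NAME = the landed
`GenusSupplyNarrow.Lossless.OfWallU2.k1Neg_of_wallItems_of_minimalTwinBSDTwo` on the six stubs (WALL row 1 × 4, U₂, print).
[cite: GrossZagier1986, V.§2 (2.2)] [cite: Kramer1981, Thm. 1] [cite: Milne1972ArithmeticAV, §1 Thm. 1] -/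
theorem K1Neg_of : K1Neg :=
  Summit.BirchSwinnertonDyer.BirchSwinnertonDyer.Theorems.GenusSupplyNarrow.Lossless.OfWallU2.k1Neg_of_wallItems_of_minimalTwinBSDTwo
    stub_wallGoodOrdinaryRankZeroAtTwo stub_wallMultiplicativeRankZeroAtTwo stub_wallSupersingularRankZeroAtTwo
    stub_wallAdditiveRankZeroAtTwo stub_minimalTwinBSDTwo stub_printItems.1 stub_printItems.2.1 stub_printItems.2.2.1
    stub_printItems.2.2.2

end Summit.BirchSwinnertonDyer.BirchSwinnertonDyer.Cruxes.K1Neg.WallU2Byname
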